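import Mathlib.Analysis.InnerProductSpace.Calculus
import Mathlib.Analysis.SpecialFunctions.Sqrt
import Literature.Geometry.Lorentzian.TameGenericityDiagonal
import HarnessLib

/-!
# Tame genericity is LOCAL in the parameter: witness families need only avoid the exceptional set
# near the base point

`TameGenericity.lean` asks the witness family `F : ℝᵐ → InitialDataSet (𝓡 3) X` through an
exceptional datum `d = F 0` to avoid the exceptional set `𝓔` at EVERY parameter `c ≠ 0`
(`InitialDataSet.HasTameCodimAtLeastIn`). Christodoulou's genericity (CQG **16** (1999) A23,
p. A24; Ann. Math. **149** (1999) 183, p. 187) is a statement about the exceptional set NEAR `d`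
("the exceptional set has positive codimension"), and every construction of witness families —
perturbative in the parameter — controls small parameters only. This file proves that the two
readings agree for the tree's tame notion: a family avoiding `𝓔` for `0 < ‖c‖ < ε` is converted
into one avoiding `𝓔` for all `c ≠ 0` by the **radial reparametrisation**
`c ↦ ε (1 + ‖c‖²)^{-1/2} c` of the parameter space (smooth, injective, fixing `0`, with image in the
`ε`-ball and derivative `ε · id` at `0`), under which joint smoothness, tameness on the end
(`IsTameDataFamily.comp_contDiff`), injectivity and IMMERSION at the base point are preserved.

* `InitialDataSet.IsImmersedAtZero.comp_of_injective_fderiv` — immersion at `0` is preserved under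
  a reparametrisation `φ` with `φ 0 = 0`, differentiable at `0` with injective differential
  (chain rule);
* `exists_contDiff_radialContraction` — the radial reparametrisation and its five properties
  (no definition is introduced: the map is exhibited inside the statement);
* `InitialDataSet.hasTameCodimAtLeastIn_of_local`, `InitialDataSet.isTameChristodoulouGeneric_of_local`
  — LOCAL avoidance (`0 < ‖c‖ < ε`) suffices for tame codimension / tame genericity;
* `InitialDataSet.exists_tameCurve_of_local` — the curve form used by relative assemblies
  (`isTameChristodoulouGeneric_of_relative'`): a tame injective immersed curve of `𝓓`-data whose
  members with `0 < ‖c‖ < ε` satisfy `P` yields one whose members off `0` all satisfy `P`, through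
  the same base datum and on the same end.

Sources: D. Christodoulou, CQG 16 (1999) A23, p. A24; Ann. Math. 149 (1999) 183, p. 187. The
statements are folklore bookkeeping over `TameGenericity.lean`; nothing analytic is claimed.
-/

open Manifold Bundle TopologicalSpace Filter Function
open scoped ContDiff Topology ENNReal

noncomputable section

namespace Literature.Geometry.Lorentzian

/-! ### The radial reparametrisation of a parameter space -/

section Radial

variable {V : Type*} [NormedAddCommGroup V] [InnerProductSpace ℝ V]

/-- **Radial contraction of a real inner product space into the `ε`-ball.** For `ε > 0` the map
`φ c = (ε (1 + ‖c‖²)^{-1/2}) • c` is `C^∞`, injective, fixes `0`, has `‖φ c‖ < ε` for every `c`,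
and has differential `ε • id` at `0` (in particular an injective one). Exhibited, not defined.
[folklore] -/
theorem exists_contDiff_radialContraction {ε : ℝ} (hε : 0 < ε) :
    ∃ φ : V → V, ContDiff ℝ ∞ φ ∧ Injective φ ∧ φ 0 = 0 ∧ (∀ c, ‖φ c‖ < ε) ∧
      (∀ c, φ c = 0 → c = 0) ∧ fderiv ℝ φ 0 = ε • ContinuousLinearMap.id ℝ V := by
  -- the scalar factor `ρ c = ε (1 + ‖c‖²)^{-1/2}`
  set ρ : V → ℝ := fun c ↦ ε * (Real.sqrt (1 + ‖c‖ ^ 2))⁻¹ with hρ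
  have hpos : ∀ c : V, 0 < 1 + ‖c‖ ^ 2 := fun c ↦ by positivity
  have hsqrt_pos : ∀ c : V, 0 < Real.sqrt (1 + ‖c‖ ^ 2) := fun c ↦ Real.sqrt_pos.mpr (hpos c)
  have hρ_pos : ∀ c, 0 < ρ c := fun c ↦ mul_pos hε (inv_pos.mpr (hsqrt_pos c))
  have hρ_smooth : ContDiff ℝ ∞ ρ := by
    refine contDiff_const.mul (ContDiff.inv ?_ fun c ↦ (hsqrt_pos c).ne')
    exact (contDiff_const.add (contDiff_norm_sq ℝ)).sqrt fun c ↦ (hpos c).ne'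
  have hρ0 : ρ 0 = ε := by simp [hρ]
  refine ⟨fun c ↦ ρ c • c, hρ_smooth.smul contDiff_id, ?_, by simp, ?_, ?_, ?_⟩
  · -- injectivity: norms first (`t ↦ t² / (1 + t²)` is injective on `t ≥ 0`), then the vector
    intro c c' h
    simp only at h
    have hn : ‖ρ c • c‖ = ‖ρ c' • c'‖ := by rw [h]
    rw [norm_smul, norm_smul, Real.norm_of_nonneg (hρ_pos c).le,
      Real.norm_of_nonneg (hρ_pos c').le] at hn
    have hsq : (ρ c * ‖c‖) ^ 2 = (ρ c' * ‖c'‖) ^ 2 := by rw [hn]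
    have key : ∀ x : V, (ρ x * ‖x‖) ^ 2 * (1 + ‖x‖ ^ 2) = ε ^ 2 * ‖x‖ ^ 2 := by
      intro x
      have hs : Real.sqrt (1 + ‖x‖ ^ 2) ^ 2 = 1 + ‖x‖ ^ 2 := Real.sq_sqrt (hpos x).le
      simp only [hρ]
      rw [mul_pow, mul_pow, inv_pow, hs]
      field_simp
    have hnorm : ‖c‖ ^ 2 = ‖c'‖ ^ 2 := by
      have h1 := key c
      have h2 := key c'
      rw [hsq] at h1
      -- `(ρ c' ‖c'‖)² (1 + ‖c‖²) = ε² ‖c‖²` and `(ρ c' ‖c'‖)² (1 + ‖c'‖²) = ε² ‖c'‖²`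
      have h3 : (ρ c' * ‖c'‖) ^ 2 = ε ^ 2 * ‖c'‖ ^ 2 / (1 + ‖c'‖ ^ 2) := by
        rw [eq_div_iff (hpos c').ne']
        exact h2
      rw [h3] at h1
      have hε2 : 0 < ε ^ 2 := by positivity
      field_simp at h1
      nlinarith [h1, hε2, sq_nonneg ‖c‖, sq_nonneg ‖c'‖, mul_pos hε2 (hpos c), mul_pos hε2 (hpos c')]
    have hρρ : ρ c = ρ c' := by simp only [hρ, hnorm]
    rw [hρρ] at h
    exact smul_right_injective V (hρ_pos c').ne' h
  · -- image in the `ε`-ball: `‖φ c‖ = ε ‖c‖ / √(1 + ‖c‖²) < ε`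
    intro c
    rw [norm_smul, Real.norm_of_nonneg (hρ_pos c).le, hρ]
    have hlt : ‖c‖ < Real.sqrt (1 + ‖c‖ ^ 2) := by
      rw [Real.lt_sqrt (norm_nonneg c)]
      linarith
    calc ε * (Real.sqrt (1 + ‖c‖ ^ 2))⁻¹ * ‖c‖
        = ε * (‖c‖ / Real.sqrt (1 + ‖c‖ ^ 2)) := by ring
      _ < ε * 1 := by
          refine mul_lt_mul_of_pos_left ?_ hε
          rwa [div_lt_one (hsqrt_pos c)]
      _ = ε := mul_one ε
  · -- `φ c = 0 → c = 0`
    intro c hc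
    rcases smul_eq_zero.mp hc with h | h
    · exact absurd h (hρ_pos c).ne'
    · exact h
  · -- differential at `0`
    have hd : HasFDerivAt (fun c ↦ ρ c • c)
        (ρ 0 • ContinuousLinearMap.id ℝ V + (fderiv ℝ ρ 0).smulRight (0 : V)) 0 := by
      have h1 : HasFDerivAt ρ (fderiv ℝ ρ 0) 0 :=
        (hρ_smooth.differentiable (by simp) 0).hasFDerivAt
      have h2 : HasFDerivAt (fun c : V ↦ c) (ContinuousLinearMap.id ℝ V) 0 := hasFDerivAt_id 0
      exact h1.smul h2
    rw [hd.fderiv, hρ0]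
    ext v
    simp

end Radial

namespace InitialDataSet

/-! ### Immersion at the base point under reparametrisation -/

section Immersion

variable {E : Type*} [NormedAddCommGroup E] [NormedSpace ℝ E] {H : Type*} [TopologicalSpace H]
  {I : ModelWithCorners ℝ E H} {X : Type*} [TopologicalSpace X] [ChartedSpace H X]
  [IsManifold I ∞ X]

/-- **Immersion at the base point is preserved under reparametrisation with injective
differential.** If the `m`-parameter family `F` is immersed at `0` (`IsImmersedAtZero`) and
`φ : ℝᵐ' → ℝᵐ` fixes `0`, is differentiable at `0` and has injective differential there, then
`F ∘ φ` is immersed at `0`: for `v ≠ 0` the direction `dφ₀ v ≠ 0` is detected by some scalar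
component `c ↦ h_c(x)(u, w)` or `c ↦ k_c(x)(u, w)` of `F`, and the chain rule transports the
non-vanishing derivative (a scalar component with non-zero `fderiv` is differentiable at `0`).
[folklore] -/
theorem IsImmersedAtZero.comp_of_injective_fderiv {m m' : ℕ}
    {F : EuclideanSpace ℝ (Fin m) → InitialDataSet I X} (hF : IsImmersedAtZero m F)
    {φ : EuclideanSpace ℝ (Fin m') → EuclideanSpace ℝ (Fin m)} (h0 : φ 0 = 0)
    (hφ : DifferentiableAt ℝ φ 0) (hinj : Injective (fderiv ℝ φ 0)) :
    IsImmersedAtZero m' (fun c ↦ F (φ c)) := by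
  intro v hv
  have hv' : fderiv ℝ φ 0 v ≠ 0 := fun h ↦ hv (hinj (by rw [h, map_zero]))
  obtain ⟨x, u, w, huw⟩ := hF (fderiv ℝ φ 0 v) hv'
  refine ⟨x, u, w, ?_⟩
  -- chain rule for a scalar component `g` with `fderiv g 0 (dφ₀ v) ≠ 0`
  have chain : ∀ g : EuclideanSpace ℝ (Fin m) → ℝ, fderiv ℝ g 0 (fderiv ℝ φ 0 v) ≠ 0 →
      fderiv ℝ (fun c ↦ g (φ c)) 0 v ≠ 0 := by
    intro g hg
    have hgd : DifferentiableAt ℝ g (φ 0) := by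
      rw [h0]
      by_contra hnd
      rw [fderiv_zero_of_not_differentiableAt hnd] at hg
      exact hg rfl
    have hc : fderiv ℝ (fun c ↦ g (φ c)) 0 = (fderiv ℝ g (φ 0)).comp (fderiv ℝ φ 0) :=
      fderiv_comp 0 hgd hφ
    rw [hc, ContinuousLinearMap.comp_apply, h0]
    exact hg
  rcases huw with h | h
  · exact Or.inl (chain (fun c ↦ (F c).h.inner x u w) h)
  · exact Or.inr (chain (fun c ↦ (F c).k x u w) h)

end Immersion

/-! ### Local avoidance suffices -/

variable {X : Type*} [TopologicalSpace X] [ChartedSpace E3 X] [IsManifold (𝓡 3) ∞ X]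

/-- **A tame injective immersed curve/family whose SMALL members have `P` yields one all of whose
members off `0` have `P`** (same end, same base datum, members still in `𝓓`): reparametrise by the
radial contraction into the `ε`-ball (`exists_contDiff_radialContraction`); tameness composes
(`IsTameDataFamily.comp_contDiff`), immersion composes (`IsImmersedAtZero.comp_of_injective_fderiv`,
the differential `ε • id` being injective), injectivity composes. [folklore] -/
theorem exists_tameFamily_of_local {e : AFEnd X} {m : ℕ} {𝓓 : Set (InitialDataSet (𝓡 3) X)}
    {P : InitialDataSet (𝓡 3) X → Prop} {F : EuclideanSpace ℝ (Fin m) → InitialDataSet (𝓡 3) X}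
    (hF : IsTameDataFamily e m F) (himm : IsImmersedAtZero m F) (hinj : Injective F)
    (h𝓓 : ∀ c, F c ∈ 𝓓) {ε : ℝ} (hε : 0 < ε) (hP : ∀ c, c ≠ 0 → ‖c‖ < ε → P (F c)) :
    ∃ F' : EuclideanSpace ℝ (Fin m) → InitialDataSet (𝓡 3) X,
      IsTameDataFamily e m F' ∧ F' 0 = F 0 ∧ Injective F' ∧ IsImmersedAtZero m F' ∧
        (∀ c, F' c ∈ 𝓓) ∧ ∀ c ≠ 0, P (F' c) := by
  obtain ⟨φ, hφ, hφinj, hφ0, hball, hφne, hdφ⟩ :=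
    exists_contDiff_radialContraction (V := EuclideanSpace ℝ (Fin m)) hε
  have hdinj : Injective (fderiv ℝ φ 0) := by
    rw [hdφ]
    intro v w h
    simpa [hε.ne'] using h
  refine ⟨fun c ↦ F (φ c), hF.comp_contDiff hφ hφ0, by simp [hφ0], hinj.comp hφinj,
    himm.comp_of_injective_fderiv hφ0 (hφ.differentiable (by simp) 0) hdinj, fun c ↦ h𝓓 _,
    fun c hc ↦ hP (φ c) (fun h ↦ hc (hφne c h)) (hball c)⟩

/-- **Tame finite codimension is local in the parameter.** If through every `d ∈ 𝓔` pass an end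
`e`, a tame `m`-parameter family `F` of `𝓓`-data on `e`, immersed at `0`, injective, with
`F 0 = d`, and an `ε > 0` such that the members with `0 < ‖c‖ < ε` avoid `𝓔`, then `𝓔` has tame
codimension at least `m` inside `𝓓` (`HasTameCodimAtLeastIn`, avoidance at every `c ≠ 0`).
Christodoulou, CQG 16 (1999) A23, p. A24 (positive codimension is a local property of the
exceptional set). [folklore] -/
theorem hasTameCodimAtLeastIn_of_local {𝓓 𝓔 : Set (InitialDataSet (𝓡 3) X)} {m : ℕ}
    (h : ∀ d ∈ 𝓔, ∃ (e : AFEnd X) (F : EuclideanSpace ℝ (Fin m) → InitialDataSet (𝓡 3) X),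
      IsTameDataFamily e m F ∧ IsImmersedAtZero m F ∧ F 0 = d ∧ Injective F ∧ (∀ c, F c ∈ 𝓓) ∧
        ∃ ε > (0 : ℝ), ∀ c, c ≠ 0 → ‖c‖ < ε → F c ∉ 𝓔) :
    HasTameCodimAtLeastIn 𝓓 𝓔 m := by
  intro d hd
  obtain ⟨e, F, hF, himm, h0, hinj, h𝓓, ε, hε, hE⟩ := h d hd
  obtain ⟨F', hF', hF'0, hinj', himm', h𝓓', hE'⟩ :=
    exists_tameFamily_of_local (P := fun D ↦ D ∉ 𝓔) hF himm hinj h𝓓 hε hE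
  exact ⟨e, F', hF', himm', hF'0.trans h0, hinj', h𝓓', hE'⟩

/-- **Tame Christodoulou genericity is local in the parameter**: it suffices that through every
exceptional datum passes a tame, immersed, injective family of admissible data whose members with
`0 < ‖c‖ < ε` (some `ε > 0`) satisfy `P`. Christodoulou, CQG 16 (1999) A23, p. A24. [folklore] -/
theorem isTameChristodoulouGeneric_of_local {𝓓 : Set (InitialDataSet (𝓡 3) X)}
    {P : InitialDataSet (𝓡 3) X → Prop} {m : ℕ}
    (h : ∀ d ∈ 𝓓, ¬ P d → ∃ (e : AFEnd X) (F : EuclideanSpace ℝ (Fin m) → InitialDataSet (𝓡 3) X),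
      IsTameDataFamily e m F ∧ IsImmersedAtZero m F ∧ F 0 = d ∧ Injective F ∧ (∀ c, F c ∈ 𝓓) ∧
        ∃ ε > (0 : ℝ), ∀ c, c ≠ 0 → ‖c‖ < ε → P (F c)) :
    IsTameChristodoulouGeneric 𝓓 P m := by
  refine hasTameCodimAtLeastIn_of_local fun d hd ↦ ?_
  obtain ⟨e, F, hF, himm, h0, hinj, h𝓓, ε, hε, hP⟩ := h d hd.1 hd.2
  exact ⟨e, F, hF, himm, h0, hinj, h𝓓, ε, hε, fun c hc hcε hmem ↦ hmem.2 (hP c hc hcε)⟩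

/-- **Curve form, for relative assemblies.** A tame injective immersed curve of `𝓓`-data on the end
`e` whose members with `0 < ‖c‖ < ε` satisfy `P` yields an end `e'` (namely `e`) and a tame injective
immersed curve of `𝓓`-data through the same base datum all of whose members off `0` satisfy `P` —
the conclusion shape of the relative witnesses of `isTameChristodoulouGeneric_of_relative'`.
[folklore] -/
theorem exists_tameCurve_of_local {e : AFEnd X} {𝓓 : Set (InitialDataSet (𝓡 3) X)}
    {P : InitialDataSet (𝓡 3) X → Prop} {d : InitialDataSet (𝓡 3) X}
    {F : EuclideanSpace ℝ (Fin 1) → InitialDataSet (𝓡 3) X}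
    (hF : IsTameDataFamily e 1 F) (h0 : F 0 = d) (hinj : Injective F) (himm : IsImmersedAtZero 1 F)
    (h𝓓 : ∀ c, F c ∈ 𝓓) {ε : ℝ} (hε : 0 < ε) (hP : ∀ c, c ≠ 0 → ‖c‖ < ε → P (F c)) :
    ∃ (e' : AFEnd X) (F' : EuclideanSpace ℝ (Fin 1) → InitialDataSet (𝓡 3) X),
      IsTameDataFamily e' 1 F' ∧ F' 0 = d ∧ Injective F' ∧ IsImmersedAtZero 1 F' ∧
        (∀ c, F' c ∈ 𝓓) ∧ ∀ c ≠ 0, P (F' c) := by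
  obtain ⟨F', hF', hF'0, hinj', himm', h𝓓', hP'⟩ := exists_tameFamily_of_local hF himm hinj h𝓓 hε hP
  exact ⟨e, F', hF', hF'0.trans h0, hinj', himm', h𝓓', hP'⟩

end InitialDataSet

end Literature.Geometry.Lorentzian

end
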